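import Mathlib
import Literature.Geometry.Lorentzian.KerrSchildWaveCauchyProblem
import Summits.FinalStateConjecture.FinalStateConjecture.Theorems.StarvedNecksNecksCertifyStubCharacteristicCalculus

/-!
# Route StarvedNecks — crux `NecksCertify`, line `two-cap-focusing-ledger`: rung R1b

Stub `stub_kirchhoffFormula` (statement `SphericalMeansCalculus → KirchhoffFormula`, both
unfolded): the **Kirchhoff–Duhamel representation on `ℝ¹⁺³`** (Evans, *PDE*, §2.4.1(c), §2.4.2),
for every smooth `ψ : E4 → ℝ`, every apex `(t, x)` and every radius `σ > 0`,

`ψ(t,x) = ⨍ ψ(t−σ, x+σw) dσ(w) + σ ⨍ Dψ(t−σ, x+σw)·(1, w) dσ(w)`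
`         − ∫₀^σ s ⨍ (□_η ψ)(t−s, x+sw) dσ(w) ds`,

`⨍ = σ(S²)⁻¹ ∫_{S²}` for Mathlib's sphere measure `volume.toSphere`, `□_η = −∂ₜ² + Δ` the tree's
divergence-form operator `KerrSchild.waveOperator (fun _ ↦ Kerr.etaComp)`.

It is derived here from the calculus of the time-dependent spherical means
`A(s, r) = ∫_{S²} ψ(s, x + rw) dσ(w)` (the hypothesis, rung R1a-ii: joint smoothness, `∂ᵣA`, `∂ₛA`,
`∂ₛ²A` under the integral sign and Darboux's equation `∂ᵣ²(rA) = r∫Δₓψ`) by the classical `1+1`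
reduction: `Ũ = rA` satisfies `Ũₛₛ − Ũᵣᵣ = r∫(∂₀∂₀ψ − Δₓψ) = −r∫□_ηψ` (`waveOperator_eta_eq`:
`□_η = −∂₀∂₀ + ∑ᵢ ∂ᵢ∂ᵢ` on `C²` functions), the incoming derivative `Ũₛ + Ũᵣ` is transported along
the characteristic from `(t − σ, σ)` to `(t, 0)` by the landed identity `transport_inRay` of
`Theorems/StarvedNecksNecksCertifyStubCharacteristicCalculus`, and the endpoints are evaluated:
`Ũ(s, 0) = 0`, `Ũᵣ(s, 0) = A(s, 0) = σ(S²) ψ(s, x)`, `(Ũₛ + Ũᵣ)(t−σ, σ) = ∫ψ + σ∫Dψ·(1, w)`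
(`E4.ofTimeSpace 1 w = E4.basisVector 0 + E4.ofTimeSpace 0 w`).  Mathlib, the tree's
`KerrSchild.waveOperator`, and the two landed `1+1` calculus files only; no definitions.
-/

noncomputable section

open scoped Manifold ContDiff Topology ENNReal
open Filter Set MeasureTheory Topology Literature.Geometry.Lorentzian
open Summit.FinalStateConjecture.FinalStateConjecture.Theorems.Blindness
open Summit.FinalStateConjecture.FinalStateConjecture.Theorems.NecksCertifyBargmann.Calculus

namespace Summit.FinalStateConjecture.FinalStateConjecture.Theorems.NecksCertifyTwoCap.Kirchhoff

/-- **`□_η = −∂₀∂₀ + ∑ᵢ ∂ᵢ∂ᵢ` on `C²` functions.**  The divergence-form wave operator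
`∑_μ ∂_μ(η^{μν} ∂_ν u)` with the constant Minkowski coefficients `η = diag(−1, 1, 1, 1)`
(`Kerr.etaComp`), in nested-`fderiv` form. -/
theorem waveOperator_eta_eq {ψ : E4 → ℝ} (hψ : ContDiff ℝ 2 ψ) (z : E4) :
    KerrSchild.waveOperator (fun _ ↦ Kerr.etaComp) ψ z =
      -fderiv ℝ (fun y ↦ fderiv ℝ ψ y (E4.basisVector 0)) z (E4.basisVector 0) +
        ∑ i : Fin 3, fderiv ℝ (fun y ↦ fderiv ℝ ψ y (E4.basisVector i.succ)) z
          (E4.basisVector i.succ) := by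
  have hd : ∀ μ : Fin 4, DifferentiableAt ℝ (fun y ↦ fderiv ℝ ψ y (E4.basisVector μ)) z :=
    fun μ ↦ (((hψ.fderiv_right (m := 1) (by norm_num)).clm_apply contDiff_const).differentiable
      one_ne_zero) z
  have hinner : ∀ μ : Fin 4,
      (fun y : E4 ↦ ∑ ν, Kerr.etaComp μ ν * fderiv ℝ ψ y (E4.basisVector ν)) =
        fun y ↦ Kerr.etaComp μ μ * fderiv ℝ ψ y (E4.basisVector μ) := by
    intro μ
    funext y
    rw [Finset.sum_eq_single μ (fun ν _ hν ↦ ?_) (fun h ↦ absurd (Finset.mem_univ μ) h)]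
    have h0 : Kerr.etaComp μ ν = 0 := by simp [Kerr.etaComp, Ne.symm hν]
    rw [h0, zero_mul]
  have hderiv : ∀ μ : Fin 4,
      fderiv ℝ (fun y : E4 ↦ ∑ ν, Kerr.etaComp μ ν * fderiv ℝ ψ y (E4.basisVector ν)) z
          (E4.basisVector μ) =
        Kerr.etaComp μ μ * fderiv ℝ (fun y ↦ fderiv ℝ ψ y (E4.basisVector μ)) z
          (E4.basisVector μ) := by
    intro μ
    rw [hinner μ, fderiv_const_mul (hd μ)]
    rfl
  rw [KerrSchild.waveOperator_apply]
  simp only [hderiv]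
  rw [Fin.sum_univ_succ]
  have h0 : Kerr.etaComp 0 0 = -1 := by simp [Kerr.etaComp]
  have hs : ∀ i : Fin 3, Kerr.etaComp i.succ i.succ = 1 := fun i ↦ by
    simp [Kerr.etaComp, Fin.succ_ne_zero]
  simp only [h0, hs, neg_one_mul, one_mul]

/-- The transversal direction of Kirchhoff's formula: `(1, w) = ∂₀ + (0, w)` in `E4`. -/
theorem ofTimeSpace_one_eq (w : E3) :
    E4.ofTimeSpace 1 w = E4.basisVector 0 + E4.ofTimeSpace 0 w := by
  ext i
  refine Fin.cases ?_ (fun j ↦ ?_) i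
  · simp [E4.basisVector]
  · simp [E4.basisVector, Fin.succ_ne_zero]

/-- A continuous function on `E3` is integrable on the unit sphere for the sphere measure
(compact space, finite measure). -/
theorem integrable_sphere_of_continuous {g : E3 → ℝ} (hg : Continuous g) :
    Integrable (fun w : Metric.sphere (0 : E3) 1 ↦ g (w : E3)) (volume : Measure E3).toSphere :=
  (hg.comp continuous_subtype_val).integrable_of_hasCompactSupport
    (HasCompactSupport.of_compactSpace _)

/-- The total mass of the sphere measure is a nonzero real number (`σ(S²) = 3·vol(B) ∈ (0, ∞)`). -/
theorem toSphere_univ_toReal_ne_zero : ((volume : Measure E3).toSphere univ).toReal ≠ 0 :=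
  ENNReal.toReal_ne_zero.mpr
    ⟨Measure.measure_univ_ne_zero.mpr (Measure.toSphere_ne_zero _), measure_ne_top _ _⟩

/-- Registered stub R1b of line `two-cap-focusing-ledger` (statement
`SphericalMeansCalculus → KirchhoffFormula`, both unfolded): the Kirchhoff–Duhamel representation
`ψ(t,x) = ⨍ψ(t−σ, x+σw) + σ⨍Dψ(t−σ, x+σw)(1, w) − ∫₀^σ s⨍(□_ηψ)(t−s, x+sw) ds` for smooth `ψ` and
`σ > 0`, from the calculus of time-dependent spherical means (joint smoothness, derivatives under
the integral sign, Darboux) by the `1+1` reduction `Ũ = rA`, transport of `Ũₛ + Ũᵣ` along the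
incoming characteristic (`transport_inRay`) and evaluation of the endpoints. -/
theorem stub_kirchhoffFormula :
  (∀ (ψ : E4 → ℝ), ContDiff ℝ ∞ ψ → ∀ (x : E3) (A : ℝ → ℝ → ℝ),
    (∀ s r, A s r = ∫ (w : Metric.sphere (0 : E3) 1), ψ (E4.ofTimeSpace s (x + r • (w : E3))) ∂((volume : Measure E3).toSphere)) →
    ContDiff ℝ ∞ (Function.uncurry A) ∧
    (∀ s r, deriv (A s) r =
      ∫ (w : Metric.sphere (0 : E3) 1), fderiv ℝ ψ (E4.ofTimeSpace s (x + r • (w : E3))) (E4.ofTimeSpace 0 (w : E3)) ∂((volume : Measure E3).toSphere)) ∧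
    (∀ s r, deriv (fun s' ↦ A s' r) s =
      ∫ (w : Metric.sphere (0 : E3) 1), fderiv ℝ ψ (E4.ofTimeSpace s (x + r • (w : E3))) (E4.basisVector 0) ∂((volume : Measure E3).toSphere)) ∧
    (∀ s r, iteratedDeriv 2 (fun s' ↦ A s' r) s =
      ∫ (w : Metric.sphere (0 : E3) 1), fderiv ℝ (fun z ↦ fderiv ℝ ψ z (E4.basisVector 0)) (E4.ofTimeSpace s (x + r • (w : E3))) (E4.basisVector 0) ∂((volume : Measure E3).toSphere)) ∧
    (∀ s r, iteratedDeriv 2 (fun ρ ↦ ρ * A s ρ) r =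
      r * ∫ (w : Metric.sphere (0 : E3) 1), (∑ i : Fin 3, fderiv ℝ (fun z ↦ fderiv ℝ ψ z (E4.basisVector i.succ)) (E4.ofTimeSpace s (x + r • (w : E3)))
        (E4.basisVector i.succ)) ∂((volume : Measure E3).toSphere))) →
  ∀ (ψ : E4 → ℝ), ContDiff ℝ ∞ ψ → ∀ (t : ℝ) (x : E3) (σ : ℝ), 0 < σ →
    ψ (E4.ofTimeSpace t x) =
      (((volume : Measure E3).toSphere univ).toReal)⁻¹ *
          ∫ (w : Metric.sphere (0 : E3) 1), ψ (E4.ofTimeSpace (t - σ) (x + σ • (w : E3)))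
            ∂((volume : Measure E3).toSphere)
      + σ * ((((volume : Measure E3).toSphere univ).toReal)⁻¹ *
          ∫ (w : Metric.sphere (0 : E3) 1),
            fderiv ℝ ψ (E4.ofTimeSpace (t - σ) (x + σ • (w : E3))) (E4.ofTimeSpace 1 (w : E3))
            ∂((volume : Measure E3).toSphere))
      - ∫ s in (0 : ℝ)..σ, s * ((((volume : Measure E3).toSphere univ).toReal)⁻¹ *
          ∫ (w : Metric.sphere (0 : E3) 1),
            KerrSchild.waveOperator (fun _ ↦ Kerr.etaComp) ψ (E4.ofTimeSpace (t - s) (x + s • (w : E3)))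
            ∂((volume : Measure E3).toSphere)) := by
  intro H ψ hψ t x σ _hσ
  /- smoothness bookkeeping for `ψ` -/
  have hψ2 : ContDiff ℝ 2 ψ := contDiff_infty.mp hψ 2
  have hDψ : ContDiff ℝ ∞ (fderiv ℝ ψ) := (contDiff_infty_iff_fderiv.mp hψ).2
  have hD1 : ∀ v : E4, ContDiff ℝ ∞ (fun z ↦ fderiv ℝ ψ z v) := fun v ↦
    hDψ.clm_apply contDiff_const
  have hD2 : ∀ v v' : E4, Continuous (fun z ↦ fderiv ℝ (fun y ↦ fderiv ℝ ψ y v) z v') :=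
    fun v v' ↦ ((contDiff_infty_iff_fderiv.mp (hD1 v)).2.clm_apply contDiff_const).continuous
  /- the slice maps `y ↦ (s, x + r y)` and the integrands along them are continuous -/
  have hpt : ∀ s r : ℝ, Continuous (fun y : E3 ↦ E4.ofTimeSpace s (x + r • y)) := fun s r ↦
    (E4.continuous_ofTimeSpace s).comp (continuous_const.add (continuous_const_smul r))
  have hc1 : ∀ (s r : ℝ) (v : E4),
      Continuous (fun y : E3 ↦ fderiv ℝ ψ (E4.ofTimeSpace s (x + r • y)) v) := fun s r v ↦
    ((hDψ.continuous.comp (hpt s r)).clm_apply continuous_const)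
  have hc2 : ∀ s r : ℝ, Continuous
      (fun y : E3 ↦ fderiv ℝ ψ (E4.ofTimeSpace s (x + r • y)) (E4.ofTimeSpace 0 y)) := fun s r ↦
    ((hDψ.continuous.comp (hpt s r)).clm_apply (E4.continuous_ofTimeSpace 0))
  have hc3 : ∀ s r : ℝ, Continuous (fun y : E3 ↦
      -fderiv ℝ (fun z ↦ fderiv ℝ ψ z (E4.basisVector 0)) (E4.ofTimeSpace s (x + r • y))
        (E4.basisVector 0)) := fun s r ↦ ((hD2 _ _).comp (hpt s r)).neg
  have hc4 : ∀ s r : ℝ, Continuous (fun y : E3 ↦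
      ∑ i : Fin 3, fderiv ℝ (fun z ↦ fderiv ℝ ψ z (E4.basisVector i.succ))
        (E4.ofTimeSpace s (x + r • y)) (E4.basisVector i.succ)) := fun s r ↦
    continuous_finsetSum _ fun i _ ↦ (hD2 _ _).comp (hpt s r)
  /- the spherical means of `ψ` about `x` and their calculus (the hypothesis) -/
  obtain ⟨A, hAdef⟩ : ∃ A : ℝ → ℝ → ℝ, ∀ s r, A s r =
      ∫ (w : Metric.sphere (0 : E3) 1), ψ (E4.ofTimeSpace s (x + r • (w : E3)))
        ∂((volume : Measure E3).toSphere) :=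
    ⟨_, fun _ _ ↦ rfl⟩
  obtain ⟨hA, hAr, hAs, hAss, hDarb⟩ := H ψ hψ x A hAdef
  have hA2 : ContDiff ℝ 2 (Function.uncurry A) := contDiff_infty.mp hA 2
  have hA1 : ContDiff ℝ 1 (Function.uncurry A) := contDiff_infty.mp hA 1
  /- `Ũ = r A` and its slice derivatives -/
  obtain ⟨U, hUeq⟩ : ∃ U : ℝ → ℝ → ℝ, U = fun s r ↦ r * A s r := ⟨_, rfl⟩
  have hUfun : ∀ s, U s = fun ρ ↦ ρ * A s ρ := fun s ↦ by rw [hUeq]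
  have hUfun' : ∀ r, (fun s ↦ U s r) = fun s ↦ r * A s r := fun r ↦ by rw [hUeq]
  have hU : ContDiff ℝ 2 (Function.uncurry U) := by
    rw [hUeq]
    exact contDiff_snd.mul hA2
  have hU1 : ContDiff ℝ 1 (Function.uncurry U) := hU.of_le (by norm_num)
  have hUt : ∀ s r, fderiv ℝ (Function.uncurry U) (s, r) (1, 0) =
      r * deriv (fun s' ↦ A s' r) s := fun s r ↦ by
    rw [← deriv_time_eq hU1 s r, hUfun' r]
    exact deriv_const_mul_field r
  have hUr : ∀ s r, fderiv ℝ (Function.uncurry U) (s, r) (0, 1) =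
      A s r + r * deriv (A s) r := fun s r ↦ by
    rw [← deriv_space_eq hU1 s r, hUfun s]
    have h : HasDerivAt (fun ρ ↦ ρ * A s ρ) (1 * A s r + r * deriv (A s) r) r :=
      (hasDerivAt_id' r).mul (hasDerivAt_space hA1 s r).differentiableAt.hasDerivAt
    rw [h.deriv, one_mul]
  have hUtt : ∀ s r, fderiv ℝ (fderiv ℝ (Function.uncurry U)) (s, r) (1, 0) (1, 0) =
      r * iteratedDeriv 2 (fun s' ↦ A s' r) s := fun s r ↦ by
    rw [← iteratedDeriv_time_eq_snd hU s r, hUfun' r]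
    exact iteratedDeriv_const_mul_field r _
  have hUrr : ∀ s r, fderiv ℝ (fderiv ℝ (Function.uncurry U)) (s, r) (0, 1) (0, 1) =
      iteratedDeriv 2 (fun ρ ↦ ρ * A s ρ) r := fun s r ↦ by
    rw [← iteratedDeriv_space_eq_snd hU s r, hUfun s]
  /- the apex value: `A(t, 0) = σ(S²) ψ(t, x)` -/
  have hA0 : A t 0 = ((volume : Measure E3).toSphere univ).toReal * ψ (E4.ofTimeSpace t x) := by
    rw [hAdef]
    simp only [zero_smul, add_zero, integral_const, smul_eq_mul, measureReal_def]
  /- transport of `Ũₛ + Ũᵣ` along the incoming characteristic from `(t - σ, σ)` to `(t, 0)` -/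
  have htr := transport_inRay hU t 0 σ
  simp only [zero_add, hUt, hUr, hUtt, hUrr, zero_mul, add_zero, hAs, hAr, hAss, hDarb,
    hA0] at htr
  rw [hAdef (t - σ) σ] at htr
  /- the goal's sphere integrals: the transversal derivative and the d'Alembertian -/
  have hQ : (∫ (w : Metric.sphere (0 : E3) 1),
        fderiv ℝ ψ (E4.ofTimeSpace (t - σ) (x + σ • (w : E3))) (E4.ofTimeSpace 1 (w : E3))
          ∂((volume : Measure E3).toSphere)) =
      (∫ (w : Metric.sphere (0 : E3) 1),
        fderiv ℝ ψ (E4.ofTimeSpace (t - σ) (x + σ • (w : E3))) (E4.basisVector 0)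
          ∂((volume : Measure E3).toSphere)) +
      ∫ (w : Metric.sphere (0 : E3) 1),
        fderiv ℝ ψ (E4.ofTimeSpace (t - σ) (x + σ • (w : E3))) (E4.ofTimeSpace 0 (w : E3))
          ∂((volume : Measure E3).toSphere) := by
    rw [← integral_add (integrable_sphere_of_continuous (hc1 _ _ _))
      (integrable_sphere_of_continuous (hc2 _ _))]
    simp only [ofTimeSpace_one_eq, map_add]
  have hI : ∀ s : ℝ, (∫ (w : Metric.sphere (0 : E3) 1),
        KerrSchild.waveOperator (fun _ ↦ Kerr.etaComp) ψ
          (E4.ofTimeSpace (t - s) (x + s • (w : E3))) ∂((volume : Measure E3).toSphere)) =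
      -(∫ (w : Metric.sphere (0 : E3) 1), fderiv ℝ (fun z ↦ fderiv ℝ ψ z (E4.basisVector 0))
          (E4.ofTimeSpace (t - s) (x + s • (w : E3))) (E4.basisVector 0)
          ∂((volume : Measure E3).toSphere)) +
      ∫ (w : Metric.sphere (0 : E3) 1), (∑ i : Fin 3,
          fderiv ℝ (fun z ↦ fderiv ℝ ψ z (E4.basisVector i.succ))
            (E4.ofTimeSpace (t - s) (x + s • (w : E3))) (E4.basisVector i.succ))
          ∂((volume : Measure E3).toSphere) := by
    intro s
    simp only [waveOperator_eta_eq hψ2]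
    rw [integral_add (integrable_sphere_of_continuous (hc3 _ _))
      (integrable_sphere_of_continuous (hc4 _ _)), integral_neg]
  rw [hQ]
  simp only [hI]
  /- normalise both interval integrals to `∫₀^σ s (−∫∂₀∂₀ψ + ∫Δψ) ds`, then linear algebra -/
  set c : ℝ := ((volume : Measure E3).toSphere univ).toReal with hc
  have hswap : ∀ a b : ℝ, a * (c⁻¹ * b) = c⁻¹ * (a * b) := fun a b ↦ mul_left_comm a _ b
  have hfac : ∀ a b d : ℝ, a * b - a * d = -(a * (-b + d)) := fun a b d ↦ by ring
  simp only [hswap, intervalIntegral.integral_const_mul]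
  simp only [hfac, intervalIntegral.integral_neg] at htr
  have hc0 : c ≠ 0 := by
    rw [hc]
    exact toSphere_univ_toReal_ne_zero
  have hcinv : c⁻¹ * c = 1 := inv_mul_cancel₀ hc0
  linear_combination c⁻¹ * htr - ψ (E4.ofTimeSpace t x) * hcinv

end Summit.FinalStateConjecture.FinalStateConjecture.Theorems.NecksCertifyTwoCap.Kirchhoff

end
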